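import Literature.AnabelianGeometry.SemiGraphs.SubgroupPresentationCosetGraph
import HarnessLib

/-!
# Arithmetic compatibility data for a subgroup presentation: conjugators ([SemiAnbd] §5 pp. 62, 65–66)

Mochizuki, *Semi-graphs of anabelioids*, Publ. RIMS **42** (2006), §5: Def. 5.1 (i) p. 62 (an action
`ρ_𝒢 : π̂₁(A) → Aut(𝒢)` and the "inner action" of `π̂₁(A)`), p. 65 ("decomposition groups
`Π^temp_{𝔊,v} ⊆ Π^temp_𝔊` … well-defined up to conjugation in `Π^temp_𝔊`") and the proof of Thm. 5.4
p. 66 ("entirely parallel" to Thm. 3.7: the arithmetic tempered group acts on the trees of the Galois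
tower) [cite: MochizukiSemiAnbd2006, Thm 5.4, p. 66].

PURE GROUP THEORY (cell row T54-B, tower third, file T1b = conjugators and their calculus; the action
itself is `SubgroupPresentationArithAction.lean`; plan/GAP-LEDGER.md G-w4d053-1).  For a
subgroup presentation `P` of `𝔾` inside `Γ` (`SubgroupPresentationCosetGraph.lean`), a group `E` acting
on `Γ` by automorphisms `Φ : E →* MulAut Γ` and on `𝔾` by `σ : E →* Aut 𝔾`, such that `Φ e` carries
`H_w` to a conjugate of `H_{σ_e w}` and is compatible with the branch elements (`IsArithCompatible`,
the branch-granular compatibility of the cell's `ArithChartBranchAction`), every `Φ`-stable level `K`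
carries a CANONICAL action `E →* Aut (P.cosetGraph K)`: on vertices `H_w y K ↦ H_{σ_e w} k⁻¹ Φ_e(y) K`
for ANY `k` with `Φ_e(H_w) = k H_{σ_e w} k⁻¹` (independence of `k` = self-normalisation of the vertex
subgroups), on edges likewise.  It COVERS `σ`, commutes with the transition maps, and EXTENDS the deck
action of `Γ` along any `ι : Γ →* E` with `Φ (ι g) = conj g`, `σ (ι g) = 1` (the inner action).  Nothing
here bears on [IUTchIII] Cor. 3.12.
-/

namespace Literature.AnabelianGeometry.SemiGraphs

namespace SemiGraph

open CategoryTheory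

universe u v

variable {𝔾 : SemiGraph.{u}} {Γ : Type u} [Group Γ] {E : Type v} [Group E]

/-! ### Automorphisms of a semi-graph: bookkeeping -/

/-- The vertex map of a product of automorphisms. [cite: MochizukiSemiAnbd2006, §1 p.11] -/
theorem aut_mul_vertexMap (f g : Aut 𝔾) (w : 𝔾.Vertex) :
    (f * g).hom.vertexMap w = f.hom.vertexMap (g.hom.vertexMap w) := rfl

/-- The edge map of a product of automorphisms. [cite: MochizukiSemiAnbd2006, §1 p.11] -/
theorem aut_mul_edgeMap (f g : Aut 𝔾) (ε : 𝔾.Edge) :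
    (f * g).hom.edgeMap ε = f.hom.edgeMap (g.hom.edgeMap ε) := rfl

/-- The branch map of a product of automorphisms. [cite: MochizukiSemiAnbd2006, §1 p.11] -/
theorem aut_mul_branchMap (f g : Aut 𝔾) (b : 𝔾.Branch) :
    (f * g).hom.branchMap b = f.hom.branchMap (g.hom.branchMap b) := rfl

/-- The vertex map of the identity automorphism. [cite: MochizukiSemiAnbd2006, §1 p.11] -/
theorem aut_one_vertexMap (w : 𝔾.Vertex) : (1 : Aut 𝔾).hom.vertexMap w = w := rfl

/-- The edge map of the identity automorphism. [cite: MochizukiSemiAnbd2006, §1 p.11] -/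
theorem aut_one_edgeMap (ε : 𝔾.Edge) : (1 : Aut 𝔾).hom.edgeMap ε = ε := rfl

/-- The branch map of the identity automorphism. [cite: MochizukiSemiAnbd2006, §1 p.11] -/
theorem aut_one_branchMap (b : 𝔾.Branch) : (1 : Aut 𝔾).hom.branchMap b = b := rfl

/-- An automorphism is injective on branches. [cite: MochizukiSemiAnbd2006, §1 p.11] -/
theorem aut_branchMap_injective (f : Aut 𝔾) : Function.Injective f.hom.branchMap := by
  intro b₁ b₂ h
  have := congrArg (fun φ : 𝔾 ⟶ 𝔾 => φ.branchMap) f.hom_inv_id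
  have h1 := congrFun this b₁
  have h2 := congrFun this b₂
  simp only [comp_branchMap, Function.comp_apply, id_branchMap, id_eq] at h1 h2
  rw [← h1, ← h2, h]

namespace SubgroupPresentation

variable (P : SubgroupPresentation 𝔾 Γ) (Φ : E →* MulAut Γ) (σ : E →* Aut 𝔾)

/-! ### Conjugators -/

/-- `k` is a *vertex conjugator* for `e` at `w`: `Φ_e(H_w) = k H_{σ_e w} k⁻¹`, stated elementwise.
[cite: MochizukiSemiAnbd2006, §5 p.65] -/
def IsVConj (e : E) (w : 𝔾.Vertex) (k : Γ) : Prop :=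
  ∀ x : Γ, x ∈ P.H w ↔ k⁻¹ * Φ e x * k ∈ P.H ((σ e).hom.vertexMap w)

/-- `m` is an *edge conjugator* for `e` at `ε`: `Φ_e(M_ε) ≤ m M_{σ_e ε} m⁻¹` and, for every branch
`b : ε → w`, compatibility with the branch elements: `s_{σ_e b} m⁻¹ Φ_e(s_b)⁻¹ k ∈ H_{σ_e w}` for some
vertex conjugator `k` (the branch-granular clause of the cell's `ArithChartBranchAction`).
[cite: MochizukiSemiAnbd2006, §5 p.65] -/
def IsEConj (e : E) (ε : 𝔾.Edge) (m : Γ) : Prop :=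
  (∀ x ∈ P.M ε, m⁻¹ * Φ e x * m ∈ P.M ((σ e).hom.edgeMap ε)) ∧
    ∀ (b : 𝔾.Branch) (w : 𝔾.Vertex), 𝔾.edgeOf b = ε → 𝔾.abuts b = some w →
      ∃ k : Γ, P.IsVConj Φ σ e w k ∧
        P.s ((σ e).hom.branchMap b) * m⁻¹ * (Φ e (P.s b))⁻¹ * k ∈ P.H ((σ e).hom.vertexMap w)

/-- **Compatibility of the arithmetic data with the presentation** (the hypotheses under which the
arithmetic action on the coset semi-graphs is canonical): vertex subgroups are self-normalising
([SemiAnbd] Cor. 2.7 (i), commensurable terminality); `𝔾` is a graph (Thm. 5.4: "arithmetic graphs of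
anabelioids") and every edge subgroup is the meet of its two positioned vertex subgroups (Thm. 3.7 (iv)
clause 2: edge-like = intersection of the two verticial subgroups); vertex and edge conjugators exist
for every `e ∈ E` (Def. 5.1 (i): `ρ` acts by automorphisms of the semi-graph of anabelioids).
[cite: MochizukiSemiAnbd2006, Thm 5.4, p. 66] -/
structure IsArithCompatible : Prop where
  /-- `N_Γ(H_w) = H_w` -/
  selfNormalizing : ∀ (w : 𝔾.Vertex) (n : Γ), (∀ x : Γ, x ∈ P.H w ↔ n⁻¹ * x * n ∈ P.H w) → n ∈ P.H w
  /-- every branch abuts to a vertex -/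
  abuts_isSome : ∀ b : 𝔾.Branch, (𝔾.abuts b).isSome
  /-- `M_ε = s_b⁻¹ H_w s_b ∩ s_{b'}⁻¹ H_{w'} s_{b'}` for the two branches `b : ε → w`, `b' : ε → w'` -/
  edge_eq_inf : ∀ (b b' : 𝔾.Branch) (w w' : 𝔾.Vertex), b ≠ b' → 𝔾.edgeOf b = 𝔾.edgeOf b' →
    𝔾.abuts b = some w → 𝔾.abuts b' = some w' → ∀ x : Γ,
      x ∈ P.M (𝔾.edgeOf b) ↔ P.s b * x * (P.s b)⁻¹ ∈ P.H w ∧ P.s b' * x * (P.s b')⁻¹ ∈ P.H w'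
  /-- vertex conjugators exist -/
  exists_isVConj : ∀ (e : E) (w : 𝔾.Vertex), ∃ k : Γ, P.IsVConj Φ σ e w k
  /-- edge conjugators exist -/
  exists_isEConj : ∀ (e : E) (ε : 𝔾.Edge), ∃ m : Γ, P.IsEConj Φ σ e ε m

variable {P Φ σ}

namespace IsVConj

/-- Transport of membership through a vertex conjugator, inverse direction.
[cite: MochizukiSemiAnbd2006, §5 p.65] -/
theorem mem_iff_symm {e : E} {w : 𝔾.Vertex} {k : Γ} (hk : P.IsVConj Φ σ e w k) (x : Γ) :
    x ∈ P.H ((σ e).hom.vertexMap w) ↔ (Φ e)⁻¹ (k * x * k⁻¹) ∈ P.H w := by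
  rw [hk]
  simp [mul_assoc]

/-- Two vertex conjugators for the same `(e, w)` differ by an element of `H_{σ_e w}` (self-normalisation).
[cite: MochizukiSemiAnbd2006, §5 p.65] -/
theorem inv_mul_mem (hP : P.IsArithCompatible Φ σ) {e : E} {w : 𝔾.Vertex} {k k' : Γ}
    (hk : P.IsVConj Φ σ e w k) (hk' : P.IsVConj Φ σ e w k') :
    k⁻¹ * k' ∈ P.H ((σ e).hom.vertexMap w) := by
  refine hP.selfNormalizing _ _ fun x => ?_
  rw [hk.mem_iff_symm, hk' ((Φ e)⁻¹ (k * x * k⁻¹))]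
  simp only [MulEquiv.apply_symm_apply, MulAut.inv_apply]
  constructor <;> intro h <;> simpa [mul_assoc] using h

/-- The identity conjugator for `e = 1`. [cite: MochizukiSemiAnbd2006, §5 p.65] -/
theorem one (w : 𝔾.Vertex) : P.IsVConj Φ σ 1 w 1 := by
  intro x; simp [aut_one_vertexMap]

/-- Composition of vertex conjugators. [cite: MochizukiSemiAnbd2006, §5 p.65] -/
theorem mul {e₁ e₂ : E} {w : 𝔾.Vertex} {k₁ k₂ : Γ}
    (h₁ : P.IsVConj Φ σ e₁ ((σ e₂).hom.vertexMap w) k₁) (h₂ : P.IsVConj Φ σ e₂ w k₂) :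
    P.IsVConj Φ σ (e₁ * e₂) w (Φ e₁ k₂ * k₁) := by
  intro x
  rw [h₂ x, h₁, map_mul σ, aut_mul_vertexMap]
  simp [map_mul, mul_assoc]

/-- The deck conjugator: for `Φ e = conj g` and `σ e = 1`, `g` is a vertex conjugator.
[cite: MochizukiSemiAnbd2006, §5 p.65] -/
theorem of_inner {e : E} {g : Γ} (hΦ : Φ e = MulAut.conj g) (hσ : σ e = 1) (w : 𝔾.Vertex) :
    P.IsVConj Φ σ e w g := by
  intro x; simp [hΦ, hσ, aut_one_vertexMap, mul_assoc]

end IsVConj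

/-! ### Well-definedness and independence of the vertex and edge maps -/

section Maps

variable (K : Subgroup Γ) (hK : ∀ (e : E) (x : Γ), x ∈ K → Φ e x ∈ K)
include hK

/-- The vertex map `y ↦ k⁻¹ Φ_e(y)` respects double cosets. [cite: MochizukiSemiAnbd2006, Thm 5.4, p. 66] -/
theorem mk_vertex_eq_of_mk_eq {e : E} {w : 𝔾.Vertex} {k : Γ} (hk : P.IsVConj Φ σ e w k) {y y' : Γ}
    (hy : DoubleCoset.mk (P.H w) K y = DoubleCoset.mk (P.H w) K y') :
    DoubleCoset.mk (P.H ((σ e).hom.vertexMap w)) K (k⁻¹ * Φ e y) =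
      DoubleCoset.mk (P.H ((σ e).hom.vertexMap w)) K (k⁻¹ * Φ e y') := by
  obtain ⟨a, ha, c, hc, rfl⟩ := (DoubleCoset.eq _ _ _ _).mp hy
  refine (DoubleCoset.eq _ _ _ _).mpr ⟨k⁻¹ * Φ e a * k, (hk a).mp ha, Φ e c, hK e c hc, ?_⟩
  simp only [map_mul]; group

/-- The edge map `y ↦ m⁻¹ Φ_e(y)` respects double cosets. [cite: MochizukiSemiAnbd2006, Thm 5.4, p. 66] -/
theorem mk_edge_eq_of_mk_eq {e : E} {ε : 𝔾.Edge} {m : Γ} (hm : P.IsEConj Φ σ e ε m) {y y' : Γ}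
    (hy : DoubleCoset.mk (P.M ε) K y = DoubleCoset.mk (P.M ε) K y') :
    DoubleCoset.mk (P.M ((σ e).hom.edgeMap ε)) K (m⁻¹ * Φ e y) =
      DoubleCoset.mk (P.M ((σ e).hom.edgeMap ε)) K (m⁻¹ * Φ e y') := by
  obtain ⟨a, ha, c, hc, rfl⟩ := (DoubleCoset.eq _ _ _ _).mp hy
  refine (DoubleCoset.eq _ _ _ _).mpr ⟨m⁻¹ * Φ e a * m, hm.1 a ha, Φ e c, hK e c hc, ?_⟩
  simp only [map_mul]; group

omit hK in
/-- INDEPENDENCE of the vertex map from the vertex conjugator. [cite: MochizukiSemiAnbd2006, Thm 5.4, p. 66] -/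
theorem mk_vertex_indep (hP : P.IsArithCompatible Φ σ) {e : E} {w : 𝔾.Vertex} {k k' : Γ}
    (hk : P.IsVConj Φ σ e w k) (hk' : P.IsVConj Φ σ e w k') (y : Γ) :
    DoubleCoset.mk (P.H ((σ e).hom.vertexMap w)) K (k⁻¹ * Φ e y) =
      DoubleCoset.mk (P.H ((σ e).hom.vertexMap w)) K (k'⁻¹ * Φ e y) := by
  refine (DoubleCoset.eq _ _ _ _).mpr ⟨(k⁻¹ * k')⁻¹, inv_mem (hk.inv_mul_mem hP hk'), 1, one_mem _, ?_⟩
  group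

omit hK in
/-- Two edge conjugators for the same `(e, ε)` differ by an element of `M_{σ_e ε}` (edge subgroup =
meet of the two positioned vertex subgroups). [cite: MochizukiSemiAnbd2006, Thm 5.4, p. 66] -/
theorem IsEConj.inv_mul_mem (hP : P.IsArithCompatible Φ σ) {e : E} {ε : 𝔾.Edge} {m m' : Γ}
    (hm : P.IsEConj Φ σ e ε m) (hm' : P.IsEConj Φ σ e ε m') :
    m⁻¹ * m' ∈ P.M ((σ e).hom.edgeMap ε) := by
  obtain ⟨b, b', hne, hb, hb', -⟩ := 𝔾.two_branches ε
  obtain ⟨w, hw⟩ := Option.isSome_iff_exists.mp (hP.abuts_isSome b)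
  obtain ⟨w', hw'⟩ := Option.isSome_iff_exists.mp (hP.abuts_isSome b')
  -- the image branches, edge and vertices
  have hσb : 𝔾.edgeOf ((σ e).hom.branchMap b) = (σ e).hom.edgeMap ε := by
    rw [(σ e).hom.edgeOf_branchMap, hb]
  have hσb' : 𝔾.edgeOf ((σ e).hom.branchMap b') = (σ e).hom.edgeMap ε := by
    rw [(σ e).hom.edgeOf_branchMap, hb']
  have hne' : (σ e).hom.branchMap b ≠ (σ e).hom.branchMap b' :=
    fun h => hne (aut_branchMap_injective (σ e) h)
  have key : ∀ {b₀ : 𝔾.Branch} {w₀ : 𝔾.Vertex}, 𝔾.edgeOf b₀ = ε → 𝔾.abuts b₀ = some w₀ →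
      P.s ((σ e).hom.branchMap b₀) * (m⁻¹ * m') * (P.s ((σ e).hom.branchMap b₀))⁻¹ ∈
        P.H ((σ e).hom.vertexMap w₀) := by
    intro b₀ w₀ hb₀ hw₀
    obtain ⟨k, hk, hmem⟩ := hm.2 b₀ w₀ hb₀ hw₀
    obtain ⟨k', hk', hmem'⟩ := hm'.2 b₀ w₀ hb₀ hw₀
    have hkk := hk.inv_mul_mem hP hk'
    -- s m⁻¹ m' s⁻¹ = (s m⁻¹ Φ(s₀)⁻¹ k) (k⁻¹ k') (s m'⁻¹ Φ(s₀)⁻¹ k')⁻¹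
    have : P.s ((σ e).hom.branchMap b₀) * (m⁻¹ * m') * (P.s ((σ e).hom.branchMap b₀))⁻¹ =
        (P.s ((σ e).hom.branchMap b₀) * m⁻¹ * (Φ e (P.s b₀))⁻¹ * k) * (k⁻¹ * k') *
          (P.s ((σ e).hom.branchMap b₀) * m'⁻¹ * (Φ e (P.s b₀))⁻¹ * k')⁻¹ := by group
    rw [this]
    exact mul_mem (mul_mem hmem hkk) (inv_mem hmem')
  rw [← hσb, hP.edge_eq_inf _ _ _ _ hne' (hσb.trans hσb'.symm)
    ((σ e).hom.abuts_branchMap b w hw) ((σ e).hom.abuts_branchMap b' w' hw')]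
  exact ⟨key hb hw, key hb' hw'⟩

omit hK in
/-- INDEPENDENCE of the edge map from the edge conjugator. [cite: MochizukiSemiAnbd2006, Thm 5.4, p. 66] -/
theorem mk_edge_indep (hP : P.IsArithCompatible Φ σ) {e : E} {ε : 𝔾.Edge} {m m' : Γ}
    (hm : P.IsEConj Φ σ e ε m) (hm' : P.IsEConj Φ σ e ε m') (y : Γ) :
    DoubleCoset.mk (P.M ((σ e).hom.edgeMap ε)) K (m⁻¹ * Φ e y) =
      DoubleCoset.mk (P.M ((σ e).hom.edgeMap ε)) K (m'⁻¹ * Φ e y) := by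
  refine (DoubleCoset.eq _ _ _ _).mpr ⟨(m⁻¹ * m')⁻¹, inv_mem (hm.inv_mul_mem hP hm'), 1, one_mem _, ?_⟩
  group

end Maps

namespace IsEConj

/-- The identity conjugator for `e = 1`. [cite: MochizukiSemiAnbd2006, §5 p.65] -/
theorem one (ε : 𝔾.Edge) : P.IsEConj Φ σ 1 ε 1 := by
  refine ⟨fun x hx => by simpa [aut_one_edgeMap] using hx, fun b w _ hw => ⟨1, IsVConj.one w, ?_⟩⟩
  simp only [map_one, aut_one_branchMap, aut_one_vertexMap, inv_one, mul_one, MulAut.one_apply,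
    mul_inv_cancel]
  exact one_mem _

/-- Composition of edge conjugators. [cite: MochizukiSemiAnbd2006, §5 p.65] -/
theorem mul {e₁ e₂ : E} {ε : 𝔾.Edge} {m₁ m₂ : Γ}
    (h₁ : P.IsEConj Φ σ e₁ ((σ e₂).hom.edgeMap ε) m₁) (h₂ : P.IsEConj Φ σ e₂ ε m₂) :
    P.IsEConj Φ σ (e₁ * e₂) ε (Φ e₁ m₂ * m₁) := by
  refine ⟨fun x hx => ?_, fun b w hb hw => ?_⟩
  · have := h₁.1 _ (h₂.1 x hx)
    rw [map_mul, aut_mul_edgeMap]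
    simpa [map_mul, mul_assoc] using this
  · obtain ⟨k₂, hk₂, hmem₂⟩ := h₂.2 b w hb hw
    obtain ⟨k₁, hk₁, hmem₁⟩ := h₁.2 ((σ e₂).hom.branchMap b) ((σ e₂).hom.vertexMap w)
      (by rw [(σ e₂).hom.edgeOf_branchMap, hb]) ((σ e₂).hom.abuts_branchMap b w hw)
    refine ⟨Φ e₁ k₂ * k₁, IsVConj.mul hk₁ hk₂, ?_⟩
    -- rewrite the composite expression as h₁ * (k₁⁻¹ Φe₁(h₂) k₁)
    rw [map_mul σ, aut_mul_branchMap, aut_mul_vertexMap, map_mul Φ]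
    have hconj : k₁⁻¹ * Φ e₁ (P.s ((σ e₂).hom.branchMap b) * m₂⁻¹ * (Φ e₂ (P.s b))⁻¹ * k₂) * k₁ ∈
        P.H ((σ e₁).hom.vertexMap ((σ e₂).hom.vertexMap w)) := (hk₁ _).mp hmem₂
    have : P.s ((σ e₁).hom.branchMap ((σ e₂).hom.branchMap b)) * (Φ e₁ m₂ * m₁)⁻¹ *
          ((Φ e₁ * Φ e₂) (P.s b))⁻¹ * (Φ e₁ k₂ * k₁) =
        (P.s ((σ e₁).hom.branchMap ((σ e₂).hom.branchMap b)) * m₁⁻¹ *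
            (Φ e₁ (P.s ((σ e₂).hom.branchMap b)))⁻¹ * k₁) *
          (k₁⁻¹ * Φ e₁ (P.s ((σ e₂).hom.branchMap b) * m₂⁻¹ * (Φ e₂ (P.s b))⁻¹ * k₂) * k₁) := by
      simp only [map_mul, map_inv, MulAut.mul_apply]; group
    rw [this]
    exact mul_mem hmem₁ hconj

/-- The deck conjugator: for `Φ e = conj g` and `σ e = 1`, `g` is an edge conjugator.
[cite: MochizukiSemiAnbd2006, §5 p.65] -/
theorem of_inner {e : E} {g : Γ} (hΦ : Φ e = MulAut.conj g) (hσ : σ e = 1) (ε : 𝔾.Edge) :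
    P.IsEConj Φ σ e ε g := by
  refine ⟨fun x hx => by simpa [hΦ, hσ, aut_one_edgeMap, mul_assoc] using hx,
    fun b w _ hw => ⟨g, IsVConj.of_inner hΦ hσ w, ?_⟩⟩
  simp only [hΦ, hσ, aut_one_branchMap, aut_one_vertexMap, MulAut.conj_apply]
  have : P.s b * g⁻¹ * (g * P.s b * g⁻¹)⁻¹ * g = 1 := by group
  rw [this]; exact one_mem _

end IsEConj

end SubgroupPresentation

end SemiGraph

end Literature.AnabelianGeometry.SemiGraphs
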